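import Mathlib
import HarnessLib
import Summits.Ventures.LatticeQCDFlow.Scoring.ChainConfidenceInterval
import Summits.Ventures.LatticeQCDFlow.Scoring.HeatBathSweepAutocorrelation

/-!
# The production heat-bath sweep has certified error bars and confidence intervals for every
# bounded observable, from ANY start — a qualitative certificate (`ε_HB = (m/M)^{|l|+1}`)

HONEST FRAMING: exact (Metropolis-corrected) sampling algorithms for lattice gauge theory;
figures of merit are autocorrelation/cost numbers at stated couplings and volumes; no
continuum-physics claim.

Venture `LatticeQCDFlow` (cell pub-lqcd), topic `Scoring`; FANOUT row 8 (`s0-cpn-nemc`, GEN-13).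
NEW WORK of the cell, not a published result; no definition is introduced.  Compositions: the
minorisation of the systematic-scan heat-bath sweep by ITS GIBBS LAW
(`Scoring/HeatBathSweepAutocorrelation.lean`: `heatBathSweep_minorised_by_piGibbsLaw'`, constant
`(m/M)^{|l|+1}` for a joint density `m ≤ p ≤ M`; Wilson theory `ε = e^{−(b−a)(|l|+1)}` from
`a ≤ β S_W ≤ b`), with the row's certified error bar (`Scoring/ChainTimeAverage.lean`:
`variance_timeAverage_le_of_doeblin`) and confidence radius (`Scoring/ChainConfidenceInterval.lean`:
`chain_confidence_of_doeblin`, any initial law).  Nothing is cited as a fact.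

## Content

* **`heatBathSweep_variance_timeAverage_le`** (finite product of probability spaces, density
  `m ≤ p ≤ M`, scan `l` visiting every site, `e = (m/M)^{|l|+1}`): started in the Gibbs law `π`,
  `Var[(1/N) Σ_{i<N} f(X_i)] ≤ (2/e − 1) Var_π f / N` for every bounded measurable `f`, every `N ≥ 1`;
* **`heatBathSweep_confidence`** — from ANY initial law, `0 < η ≤ 1`, `C' = C + |πf|`:
  `P(|(1/N) Σ_{i<N} f(X_i) − πf| > 4C'/(eN) + √(8C'² log(2/η)/(e²N))) ≤ η`;
* **`wilson_heatBathSweep_variance_timeAverage_le`**, **`wilson_heatBathSweep_confidence`** — the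
  same for the single-link heat-bath scan of a torus Wilson theory with a continuous representation
  of a compact group and `a ≤ β S_W ≤ b`, with `e = e^{−(b−a)(|l|+1)}`.

Reading (value-free): the cell's BASELINE sampler (U(1)/SU(2) heat bath) is covered by the same
certified error-bar and confidence vocabulary as the flow sampler, at every finite volume and
coupling, from any start; the constant is astronomically bad (`e^{(b−a)(|l|+1)}`), so this is a
qualitative certificate — useful numbers are MEASURED.  NOT CLAIMED: any useful rate; SU(N ≥ 3)
Cabibbo–Marinari hits; over-relaxation composites (the minorisation survives them,
`heatBathSweep_comp_autocorrelation`, not restated here); unbounded observables.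
-/

noncomputable section

namespace Summit.Ventures.LatticeQCDFlow.Scoring

open MeasureTheory ProbabilityTheory Filter Function Summit.Ventures.LatticeQCDFlow.Exactness
open scoped ENNReal

section Product

variable {ι : Type*} [Fintype ι] [DecidableEq ι] {X : ι → Type*} [∀ i, MeasurableSpace (X i)]
variable {μ : Π i, Measure (X i)} [∀ i, IsProbabilityMeasure (μ i)] {p : (Π j, X j) → ℝ≥0∞}
variable {m M : ℝ≥0∞}

/-- **Certified error bar for the heat-bath sweep** (started in its Gibbs law): with
`e = (m/M)^{|l|+1}`, `Var[(1/N) Σ_{i<N} f(X_i)] ≤ (2/e − 1) · Var_π f / N`. -/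
theorem heatBathSweep_variance_timeAverage_le (hp : Measurable p) (hm0 : m ≠ 0) (hMtop : M ≠ ∞)
    (hmp : ∀ ω, m ≤ p ω) (hpM : ∀ ω, p ω ≤ M) {l : List ι} (hl : ∀ i, i ∈ l)
    {f : (Π j, X j) → ℝ} (hf : Measurable f) {C : ℝ} (hC : ∀ ω, |f ω| ≤ C) {N : ℕ} (hN : N ≠ 0) :
    haveI := isMarkovKernel_heatBathSweep (μ := μ) hp hm0 hMtop hmp hpM l
    Var[fun x : ℕ → (Π j, X j) => (∑ i ∈ Finset.range N, f (x i)) / N;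
        Kernel.trajMeasure (X := fun _ : ℕ => Π j, X j) (piGibbsLaw μ p)
          (fun n : ℕ => (cycle (l.map (siteHeatBath μ p))).comap
            (fun h : (i : ↥(Finset.Iic n)) → (Π j, X j) => h ⟨n, Finset.mem_Iic.2 le_rfl⟩)
            (measurable_pi_apply _))]
      ≤ (2 / (m.toReal / M.toReal) ^ (l.length + 1) - 1)
          * autocov (cycle (l.map (siteHeatBath μ p))) (piGibbsLaw μ p)
              (fun ω => f ω - ∫ ω', f ω' ∂(piGibbsLaw μ p)) 0 / N := by
  haveI := isMarkovKernel_heatBathSweep (μ := μ) hp hm0 hMtop hmp hpM l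
  haveI := isProbabilityMeasure_piGibbsLaw (μ := μ) (p := p) hm0 hMtop hmp hpM
  have hinv := heatBathSweep_invariant_piGibbsLaw (μ := μ) hp hm0 hMtop hmp hpM l
  have hmin : ∀ x {B : Set (Π j, X j)}, MeasurableSet B →
      (m * M⁻¹) ^ (l.length + 1) * piGibbsLaw μ p B ≤ cycle (l.map (siteHeatBath μ p)) x B :=
    fun x B hB => heatBathSweep_minorised_by_piGibbsLaw' hp hm0 hMtop hmp hpM hl x hB
  have hε0 : 0 < (m * M⁻¹) ^ (l.length + 1) :=
    ENNReal.pow_pos (ENNReal.mul_pos hm0 (ENNReal.inv_ne_zero.2 hMtop)) _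
  have h := variance_timeAverage_le_of_doeblin hinv hmin hε0 hf hC hN
  rwa [toReal_crudeConst] at h

/-- **Certified confidence interval for the heat-bath sweep, ANY START**: with `e = (m/M)^{|l|+1}`,
`C' = C + |πf|`, for every initial law `μ₀`, every `N ≥ 1` and every `0 < η ≤ 1`,
`P_{μ₀}(|(1/N) Σ_{i<N} f(X_i) − πf| > 4C'/(eN) + √(8C'² log(2/η)/(e² N))) ≤ η`. -/
theorem heatBathSweep_confidence (hp : Measurable p) (hm0 : m ≠ 0) (hMtop : M ≠ ∞)
    (hmp : ∀ ω, m ≤ p ω) (hpM : ∀ ω, p ω ≤ M) {l : List ι} (hl : ∀ i, i ∈ l)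
    (μ₀ : Measure (Π j, X j)) [IsProbabilityMeasure μ₀]
    {f : (Π j, X j) → ℝ} (hf : Measurable f) {C : ℝ} (hC : ∀ ω, |f ω| ≤ C) {N : ℕ} (hN : N ≠ 0)
    {η : ℝ} (hη0 : 0 < η) (hη1 : η ≤ 1) :
    haveI := isMarkovKernel_heatBathSweep (μ := μ) hp hm0 hMtop hmp hpM l
    (Kernel.trajMeasure (X := fun _ : ℕ => Π j, X j) μ₀
          (fun n : ℕ => (cycle (l.map (siteHeatBath μ p))).comap
            (fun h : (i : ↥(Finset.Iic n)) → (Π j, X j) => h ⟨n, Finset.mem_Iic.2 le_rfl⟩)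
            (measurable_pi_apply _))).real
        {x | 4 * (C + |∫ ω, f ω ∂(piGibbsLaw μ p)|) / ((m.toReal / M.toReal) ^ (l.length + 1) * N)
              + Real.sqrt (8 * (C + |∫ ω, f ω ∂(piGibbsLaw μ p)|) ^ 2 * Real.log (2 / η)
                  / (((m.toReal / M.toReal) ^ (l.length + 1)) ^ 2 * N))
            < |(∑ i ∈ Finset.range N, f (x i)) / N - ∫ ω, f ω ∂(piGibbsLaw μ p)|}
      ≤ η := by
  haveI := isMarkovKernel_heatBathSweep (μ := μ) hp hm0 hMtop hmp hpM l
  haveI := isProbabilityMeasure_piGibbsLaw (μ := μ) (p := p) hm0 hMtop hmp hpM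
  have hinv := heatBathSweep_invariant_piGibbsLaw (μ := μ) hp hm0 hMtop hmp hpM l
  have hmin : ∀ x {B : Set (Π j, X j)}, MeasurableSet B →
      (m * M⁻¹) ^ (l.length + 1) * piGibbsLaw μ p B ≤ cycle (l.map (siteHeatBath μ p)) x B :=
    fun x B hB => heatBathSweep_minorised_by_piGibbsLaw' hp hm0 hMtop hmp hpM hl x hB
  have hε0 : 0 < (m * M⁻¹) ^ (l.length + 1) :=
    ENNReal.pow_pos (ENNReal.mul_pos hm0 (ENNReal.inv_ne_zero.2 hMtop)) _
  have h := chain_confidence_of_doeblin (μ₀ := μ₀) hinv hmin hε0 hf hC hN hη0 hη1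
  rwa [toReal_crudeConst] at h

end Product

/-! ### The torus Wilson theory -/

section Wilson

open Literature.MathematicalPhysics.QuantumFieldTheory

variable {d L N : ℕ} {G : Type*} [Group G] [TopologicalSpace G] [IsTopologicalGroup G]
  [CompactSpace G] [MeasurableSpace G] [BorelSpace G] [SecondCountableTopology G]
  (ρ : G →* Matrix (Fin N) (Fin N) ℂ)

/-- **Certified error bar for the Wilson heat-bath link sweep** (started in the Wilson measure):
`Var[(1/n) Σ_{i<n} f(U_i)] ≤ (2 e^{(b−a)(|l|+1)} − 1) · Var f / n` for every bounded measurable `f`. -/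
theorem wilson_heatBathSweep_variance_timeAverage_le [NeZero L] (hρ : Continuous ρ) (β : ℝ)
    {a b : ℝ} (ha : ∀ U : GaugeConfig d L G, a ≤ β * wilsonAction ρ U)
    (hb : ∀ U : GaugeConfig d L G, β * wilsonAction ρ U ≤ b)
    {l : List (Edge d L)} (hl : ∀ e, e ∈ l) {f : GaugeConfig d L G → ℝ} (hf : Measurable f)
    {C : ℝ} (hC : ∀ U, |f U| ≤ C) {n : ℕ} (hn : n ≠ 0) :
    haveI := isMarkovKernel_heatBathSweep (μ := fun _ : Edge d L => haarProbability G)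
      (measurable_gibbsDensity (continuous_smul_wilsonAction ρ hρ β))
      (by rw [Ne, ENNReal.ofReal_eq_zero, not_le]; exact Real.exp_pos _) ENNReal.ofReal_ne_top
      (fun ω => (gibbsDensity_bounds ha hb ω).1) (fun ω => (gibbsDensity_bounds ha hb ω).2) l
    Var[fun x : ℕ → GaugeConfig d L G => (∑ i ∈ Finset.range n, f (x i)) / n;
        Kernel.trajMeasure (X := fun _ : ℕ => GaugeConfig d L G) (wilsonMeasure ρ β)
          (fun k : ℕ => (cycle (l.map (siteHeatBath (fun _ : Edge d L => haarProbability G)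
            (gibbsDensity fun U : GaugeConfig d L G => β * wilsonAction ρ U)))).comap
            (fun h : (i : ↥(Finset.Iic k)) → GaugeConfig d L G => h ⟨k, Finset.mem_Iic.2 le_rfl⟩)
            (measurable_pi_apply _))]
      ≤ (2 / Real.exp (-((b - a) * (l.length + 1))) - 1)
          * autocov (cycle (l.map (siteHeatBath (fun _ : Edge d L => haarProbability G)
              (gibbsDensity fun U : GaugeConfig d L G => β * wilsonAction ρ U)))) (wilsonMeasure ρ β)
              (fun U => f U - ∫ V, f V ∂(wilsonMeasure ρ β)) 0 / n := by
  have hS : Continuous fun U : GaugeConfig d L G => β * wilsonAction ρ U :=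
    continuous_smul_wilsonAction ρ hρ β
  rw [wilsonMeasure_eq_piGibbsLaw]
  have h := heatBathSweep_variance_timeAverage_le (μ := fun _ : Edge d L => haarProbability G)
    (p := gibbsDensity fun U : GaugeConfig d L G => β * wilsonAction ρ U) (measurable_gibbsDensity hS)
    (m := ENNReal.ofReal (Real.exp (-b))) (M := ENNReal.ofReal (Real.exp (-a)))
    (by rw [Ne, ENNReal.ofReal_eq_zero, not_le]; exact Real.exp_pos _) ENNReal.ofReal_ne_top
    (fun ω => (gibbsDensity_bounds ha hb ω).1) (fun ω => (gibbsDensity_bounds ha hb ω).2) hl hf hC hn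
  have hq : (ENNReal.ofReal (Real.exp (-b))).toReal / (ENNReal.ofReal (Real.exp (-a))).toReal
      = Real.exp (-(b - a)) := by
    rw [ENNReal.toReal_ofReal (Real.exp_pos _).le, ENNReal.toReal_ofReal (Real.exp_pos _).le,
      ← Real.exp_sub]
    ring_nf
  have e1 : Real.exp (-(b - a)) ^ (l.length + 1) = Real.exp (-((b - a) * (l.length + 1))) := by
    rw [← Real.exp_nat_mul]; congr 1; push_cast; ring
  rw [hq, e1] at h
  exact h

/-- **Certified confidence interval for the Wilson heat-bath link sweep, ANY START**: with
`e = e^{−(b−a)(|l|+1)}`, `C' = C + |πf|`, for every initial law `μ₀`, every `n ≥ 1`, `0 < η ≤ 1`: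
`P_{μ₀}(|(1/n) Σ_{i<n} f(U_i) − πf| > 4C'/(e n) + √(8C'² log(2/η)/(e² n))) ≤ η`. -/
theorem wilson_heatBathSweep_confidence [NeZero L] (hρ : Continuous ρ) (β : ℝ)
    {a b : ℝ} (ha : ∀ U : GaugeConfig d L G, a ≤ β * wilsonAction ρ U)
    (hb : ∀ U : GaugeConfig d L G, β * wilsonAction ρ U ≤ b)
    {l : List (Edge d L)} (hl : ∀ e, e ∈ l) (μ₀ : Measure (GaugeConfig d L G)) [IsProbabilityMeasure μ₀]
    {f : GaugeConfig d L G → ℝ} (hf : Measurable f) {C : ℝ} (hC : ∀ U, |f U| ≤ C) {n : ℕ} (hn : n ≠ 0)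
    {η : ℝ} (hη0 : 0 < η) (hη1 : η ≤ 1) :
    haveI := isMarkovKernel_heatBathSweep (μ := fun _ : Edge d L => haarProbability G)
      (measurable_gibbsDensity (continuous_smul_wilsonAction ρ hρ β))
      (by rw [Ne, ENNReal.ofReal_eq_zero, not_le]; exact Real.exp_pos _) ENNReal.ofReal_ne_top
      (fun ω => (gibbsDensity_bounds ha hb ω).1) (fun ω => (gibbsDensity_bounds ha hb ω).2) l
    (Kernel.trajMeasure (X := fun _ : ℕ => GaugeConfig d L G) μ₀
          (fun k : ℕ => (cycle (l.map (siteHeatBath (fun _ : Edge d L => haarProbability G)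
            (gibbsDensity fun U : GaugeConfig d L G => β * wilsonAction ρ U)))).comap
            (fun h : (i : ↥(Finset.Iic k)) → GaugeConfig d L G => h ⟨k, Finset.mem_Iic.2 le_rfl⟩)
            (measurable_pi_apply _))).real
        {x | 4 * (C + |∫ V, f V ∂(wilsonMeasure ρ β)|) / (Real.exp (-((b - a) * (l.length + 1))) * n)
              + Real.sqrt (8 * (C + |∫ V, f V ∂(wilsonMeasure ρ β)|) ^ 2 * Real.log (2 / η)
                  / (Real.exp (-((b - a) * (l.length + 1))) ^ 2 * n))
            < |(∑ i ∈ Finset.range n, f (x i)) / n - ∫ V, f V ∂(wilsonMeasure ρ β)|}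
      ≤ η := by
  have hS : Continuous fun U : GaugeConfig d L G => β * wilsonAction ρ U :=
    continuous_smul_wilsonAction ρ hρ β
  rw [wilsonMeasure_eq_piGibbsLaw]
  have h := heatBathSweep_confidence (μ := fun _ : Edge d L => haarProbability G)
    (p := gibbsDensity fun U : GaugeConfig d L G => β * wilsonAction ρ U) (measurable_gibbsDensity hS)
    (m := ENNReal.ofReal (Real.exp (-b))) (M := ENNReal.ofReal (Real.exp (-a)))
    (by rw [Ne, ENNReal.ofReal_eq_zero, not_le]; exact Real.exp_pos _) ENNReal.ofReal_ne_top
    (fun ω => (gibbsDensity_bounds ha hb ω).1) (fun ω => (gibbsDensity_bounds ha hb ω).2) hl μ₀ hf hC hn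
    hη0 hη1
  have hq : (ENNReal.ofReal (Real.exp (-b))).toReal / (ENNReal.ofReal (Real.exp (-a))).toReal
      = Real.exp (-(b - a)) := by
    rw [ENNReal.toReal_ofReal (Real.exp_pos _).le, ENNReal.toReal_ofReal (Real.exp_pos _).le,
      ← Real.exp_sub]
    ring_nf
  have e1 : Real.exp (-(b - a)) ^ (l.length + 1) = Real.exp (-((b - a) * (l.length + 1))) := by
    rw [← Real.exp_nat_mul]; congr 1; push_cast; ring
  rw [hq, e1] at h
  exact h

end Wilson

end Summit.Ventures.LatticeQCDFlow.Scoring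

end
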